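import Mathlib.Data.Matrix.Block
import Mathlib.Data.Matrix.Basic
import Mathlib.Algebra.QuadraticAlgebra.Basic
import Mathlib.Tactic
import HarnessLib

/-!
# Orlov's group `U(A × Â)` in the `2n × 2n` block model: `f̃ = J⁻¹ f† J`, so `f ∈ U ⟺ f† J f = J`;
# for `A = Eⁿ` with CM and `n ≥ 2` the group is NOT `μ · Sp_{2n}(ℤ)`

Venture cell `pub-hsemireg` (Lean root `Summits/Ventures/HSemireg/`), literature seat
`lit-w-polishchuk-orlov` (g7, 2026-08-23). Companion of `OrlovIsometryGroupCM.lean` (the `2 × 2` model,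
`n = 1`: `U(E × Ê) = μ · SL₂(ℤ)`), `OrlovIsometryGroupCMQuadratic.lean`, `OrlovIsometryGroupCMUnique.lean`
and `OrlovIsometryGroupGammaZero.lean`. It records the cell's READING ×0 for `A = Eⁿ`, `n ≥ 2`
(locator sheet `widen/LIT-W/LITW-POLISHCHUK-ORLOV-LOCATOR-SHEET.md` (Q1), TABLE row M-PO6 «print does NOT
give»): Orlov prints the INTEGRAL group only for `End(E) = ℤ` ("`A = Eⁿ`, where `E` is an elliptic curve
without complex multiplication. Then the group `U(A × Â)` is isomorphic to `Sp_{2n}(ℤ)`",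
[Orlov2002DerivedAbelian] Example 4.15, held text `paper:arxiv-alg-geom_9712017` p0013:L52–55; printed
Izv. Math. 66:3 p. 593). At the level of the ℚ-ALGEBRAIC group the block description IS printed, for every
abelian variety: [GolyshevLuntsOrlov2001MirrorAV] 5.1 (4) "`U_{A,ℚ} = {g = (a b; c d) ∈ Aut_ℚ(A × Â) |
g⁻¹ = (d̂ −b̂; −ĉ â)}`. Thus the discrete group `U(A)` defined in 4.3.1 is the arithmetic subgroup of
`U_{A,ℚ}` consisting of elements which preserve the lattice `Λ`." and 5.3.1–5.3.2 (held text
`paper:arxiv-math_9812003` p0013:L192–p0014:L45, arXiv v2 p. 20; locator sheet §C5, ×2 across seats): for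
`A^m` with the diagonal polarisation "the corresponding Rosati involution on `M(m, F)` is `Z ↦ ᵗZ′`", and
"`τ(U_{A^m,ℚ}) = {g = (a b; c d) ∈ GL(2m, F) | g⁻¹ = (ᵗd̂ −ᵗb̂; −ᵗĉ ᵗâ)}`. Thus `τ(U_{A^m,ℚ})` is the group
of isometries of the skew-hermitian form on `F^m ⊕ F^m`
`ϑ((z₁,…,z_m,z₋₁,…,z₋ₘ),(w₁,…,w_m,w₋₁,…,w₋ₘ)) = Σ_{k=1}^m z_k w′₋ₖ − z_k w′_k`" [sic: both terms are
printed with `z_k`, arXiv v2 p. 20; the second term is an evident misprint for `z₋ₖ w′_k` — the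
skew-hermitian form with Gram matrix `J = (0 1; −1 0)` used below], with real points
`U(md, md)` in Albert's case IV (5.3.2, crediting Polishchuk's thesis). The identities below are that
computation written over the ORDER `R = End(E)`, i.e. for Orlov's `U(A × Â) ⊂ Aut(A × Â) = GL₂(Mₙ(R))`
itself (= GLO's lattice-preserving `U(A)`, 5.1 (4)); the integral CM statements (what is and is not in `U`
for `n ≥ 2`) are not in print.

HONEST FRAMING: elementary identities between block matrices over a commutative ring with an endomorphism
`σ`, plus one explicit `4 × 4` example over `ℤ[i]`; DERIVED HERE, not printed statements (rule R3: never a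
quotation); nothing here constructs a derived category or an abelian variety, and nothing here says that
HC, HC_CM or HC_AV holds.

## The block model (the cell's reading of Def. 2.17 for `A = Eⁿ`; NOT a quotation)

[Orlov2002DerivedAbelian] before Def. 2.17 (p0008:L27–56): a morphism `f : A × Â → A × Â` is a matrix
`f = (α β; γ δ)`, and `f̃ := (δ̂ −β̂; −γ̂ α̂)`; `f` is ISOMETRIC iff `f̃ = f⁻¹` (Def. 2.17). For `A = Eⁿ`
with `R := End(E)` commutative, identify `Â = Êⁿ` with `A` by the product principal polarisation; then
`End(A × Â) = M₂(Mₙ(R))`, the hat of an `n × n` block `x` is its ROSATI transpose `x† := σ(x)ᵀ`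
(`σ` = the Rosati involution of `E`: the identity for `R = ℤ`, complex conjugation for a CM order), and
`f̃ = (d† −b†; −c† a†)` for `f = (a b; c d)` — for `n = 1` this is `adj(σ f)`, the model of the companion
files. Write `J := (0 1; −1 0)` (`n × n` blocks) and `f† := σ(f)ᵀ` (entrywise `σ`, then transpose).

## Results (PROVED: no named fact, no `sorry`; imports Mathlib + HarnessLib only)

* `orlovTildeBlock_eq`: `J⁻¹ f† J = f̃` (`J⁻¹ = (0 −1; 1 0)`; `blockJ_mul_blockJ'`, `blockJ'_mul_blockJ`).
* `orlovIsometricBlock_iff`: `f̃ f = 1 ⟺ f† J f = J` — so `U(Eⁿ × Êⁿ)` is, in this model, the unitary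
  group of the `σ`-sesquilinear form on `R^{2n}` with the skew-symmetric Gram matrix `J` (for `R = ℤ`,
  `σ = id`: `fᵀ J f = J`, i.e. `Sp_{2n}(ℤ)` — Example 4.15 ✓).
* `orlovIsometricBlock_mul` (products), `orlovIsometricBlock_of_map_eq_self` (`σ`-fixed symplectic
  matrices, e.g. the image of `Sp_{2n}(ℤ)`), `orlovIsometricBlock_smul_one` (scalars `z` with
  `z σ(z) = 1`): hence `μ · Sp_{2n}(ℤ) ⊆ U`.
* `orlovIsometricBlock_diag_iff`: `diag(u, v) ∈ U ⟺ u† v = 1 ∧ v† u = 1`; in particular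
  `diag(u, (u†)⁻¹) ∈ U` for every `u ∈ GLₙ(R)`.
* `gaussInt_blockDiag_isometric` + `gaussInt_blockDiag_ne_smul_intCast`: for `R = ℤ[i]`
  (`QuadraticAlgebra ℤ (-1) 0`, `σ = star`) and `n = 2`, `F := diag(i, 1, i, 1)` satisfies `F† J F = J`
  but is not `ζ · H` for any `ζ ∈ ℤ[i]` and any integer matrix `H` — so for `n ≥ 2` the CM group
  `U(Eⁿ × Êⁿ)` is STRICTLY larger than `μ_K · Sp_{2n}(ℤ)` (contrast `n = 1`, where `U = μ_K · SL₂(ℤ)` by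
  the companion files). This is the precise sense of the TABLE's «`Eⁿ × Êⁿ`, `n ≥ 2`: not `μ · Sp`».

NOT here: the structure of `U(Eⁿ × Êⁿ)` as an arithmetic group (`U(n,n)`-type over the CM order), its
generators, or any orbit computation (the cell's ENGINE-W / S4 «`U₆(ℤ[i])`» computations are separate
machine legs); Orlov's `γ_A : Auteq D^b(A) ↠ U(A × Â)` (Thm. 4.14, `k = k̄`, `char k = 0`) is cited only.
-/

namespace Summit.Ventures.HSemireg

open Matrix

section BlockModel

variable {R : Type*} [CommRing R] {n : Type*} [Fintype n] [DecidableEq n]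

-- `J := fromBlocks 0 1 (-1) 0 = (0 1; −1 0)` and `J⁻¹ = fromBlocks 0 (-1) 1 0 = (0 −1; 1 0)` in `n × n` blocks are
-- written out in full below (nothing is abbreviated or defined).

omit [Fintype n] [DecidableEq n] in
/-- The zero block is fixed by entrywise `σ`. [folklore] -/
private theorem map_zero_block (σ : R →+* R) : (0 : Matrix n n R).map σ = 0 := by
  ext i j; simp

/-- `J · J⁻¹ = 1` for `J = (0 1; −1 0)`, `J⁻¹ = (0 −1; 1 0)` in `n × n` blocks. -/
theorem blockJ_mul_blockJ' : (fromBlocks 0 1 (-1) 0 : Matrix (n ⊕ n) (n ⊕ n) R) * (fromBlocks 0 (-1) 1 0 : Matrix (n ⊕ n) (n ⊕ n) R) = 1 := by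
  simp [fromBlocks_multiply, ← fromBlocks_one]

/-- `J⁻¹ · J = 1`. -/
theorem blockJ'_mul_blockJ : (fromBlocks 0 (-1) 1 0 : Matrix (n ⊕ n) (n ⊕ n) R) * (fromBlocks 0 1 (-1) 0 : Matrix (n ⊕ n) (n ⊕ n) R) = 1 := by
  simp [fromBlocks_multiply, ← fromBlocks_one]

/-- **`f̃ = J⁻¹ f† J`**: Orlov's `f̃ = (d† −b†; −c† a†)` ([cite: Orlov2002DerivedAbelian, Def 2.17], read in the
block model with hat = Rosati transpose `x ↦ σ(x)ᵀ`) is the `J`-conjugate of `f† = σ(f)ᵀ`. DERIVED HERE. -/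
theorem orlovTildeBlock_eq (σ : R →+* R) (a b c d : Matrix n n R) :
    (fromBlocks 0 (-1) 1 0 : Matrix (n ⊕ n) (n ⊕ n) R) * ((fromBlocks a b c d).map σ)ᵀ * (fromBlocks 0 1 (-1) 0 : Matrix (n ⊕ n) (n ⊕ n) R) =
      fromBlocks (d.map σ)ᵀ (-(b.map σ)ᵀ) (-(c.map σ)ᵀ) (a.map σ)ᵀ := by
  simp [fromBlocks_transpose, fromBlocks_map, fromBlocks_multiply]

/-- **`f ∈ U ⟺ f† J f = J`.** In the block model, Orlov's isometry condition `f̃ · f = 1`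
([cite: Orlov2002DerivedAbelian, Def 2.17]; printed two-sidedly as "`f̃` coincides with the inverse to
`f`" — for square matrices over a commutative ring `f̃ · f = 1 ⟺ f · f̃ = 1`, `Matrix.mul_eq_one_comm`, so
the one-sided form loses nothing) is the unitarity of `f` for the `σ`-sesquilinear form with
Gram matrix `J` — the integral form of the printed ℚ-statement "`τ(U_{A^m,ℚ})` is the group of isometries
of the skew-hermitian form" `ϑ` (`= Σ z_k w′₋ₖ − z₋ₖ w′_k`, reading the printed `− z_k w′_k` as the misprint
it is) [cite: GolyshevLuntsOrlov2001MirrorAV, 5.3.1]; for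
`σ = id` (`End(E) = ℤ`) this is `fᵀ J f = J`, i.e. `Sp_{2n}` — Orlov's Example 4.15 (`U(Eⁿ × Êⁿ) ≅
Sp_{2n}(ℤ)` for `E` without CM). DERIVED HERE over the order `R`; not a printed statement. -/
theorem orlovIsometricBlock_iff (σ : R →+* R) (a b c d : Matrix n n R) :
    fromBlocks (d.map σ)ᵀ (-(b.map σ)ᵀ) (-(c.map σ)ᵀ) (a.map σ)ᵀ * fromBlocks a b c d = 1 ↔
      ((fromBlocks a b c d).map σ)ᵀ * (fromBlocks 0 1 (-1) 0 : Matrix (n ⊕ n) (n ⊕ n) R) * fromBlocks a b c d = (fromBlocks 0 1 (-1) 0 : Matrix (n ⊕ n) (n ⊕ n) R) := by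
  rw [← orlovTildeBlock_eq σ a b c d]
  set F := fromBlocks a b c d
  have h1 : (fromBlocks 0 1 (-1) 0 : Matrix (n ⊕ n) (n ⊕ n) R) * (fromBlocks 0 (-1) 1 0 : Matrix (n ⊕ n) (n ⊕ n) R) = 1 := blockJ_mul_blockJ'
  have h2 : (fromBlocks 0 (-1) 1 0 : Matrix (n ⊕ n) (n ⊕ n) R) * (fromBlocks 0 1 (-1) 0 : Matrix (n ⊕ n) (n ⊕ n) R) = 1 := blockJ'_mul_blockJ
  constructor
  · intro h
    calc (F.map σ)ᵀ * (fromBlocks 0 1 (-1) 0 : Matrix (n ⊕ n) (n ⊕ n) R) * F = ((fromBlocks 0 1 (-1) 0 : Matrix (n ⊕ n) (n ⊕ n) R) * (fromBlocks 0 (-1) 1 0 : Matrix (n ⊕ n) (n ⊕ n) R)) * ((F.map σ)ᵀ * (fromBlocks 0 1 (-1) 0 : Matrix (n ⊕ n) (n ⊕ n) R) * F) := by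
          rw [h1, Matrix.one_mul]
      _ = (fromBlocks 0 1 (-1) 0 : Matrix (n ⊕ n) (n ⊕ n) R) * ((fromBlocks 0 (-1) 1 0 : Matrix (n ⊕ n) (n ⊕ n) R) * (F.map σ)ᵀ * (fromBlocks 0 1 (-1) 0 : Matrix (n ⊕ n) (n ⊕ n) R) * F) := by
          simp only [Matrix.mul_assoc]
      _ = (fromBlocks 0 1 (-1) 0 : Matrix (n ⊕ n) (n ⊕ n) R) := by rw [h, Matrix.mul_one]
  · intro h
    calc (fromBlocks 0 (-1) 1 0 : Matrix (n ⊕ n) (n ⊕ n) R) * (F.map σ)ᵀ * (fromBlocks 0 1 (-1) 0 : Matrix (n ⊕ n) (n ⊕ n) R) * F = (fromBlocks 0 (-1) 1 0 : Matrix (n ⊕ n) (n ⊕ n) R) * ((F.map σ)ᵀ * (fromBlocks 0 1 (-1) 0 : Matrix (n ⊕ n) (n ⊕ n) R) * F) := by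
          simp only [Matrix.mul_assoc]
      _ = (fromBlocks 0 (-1) 1 0 : Matrix (n ⊕ n) (n ⊕ n) R) * (fromBlocks 0 1 (-1) 0 : Matrix (n ⊕ n) (n ⊕ n) R) := by rw [h]
      _ = 1 := h2

/-- **Block-diagonal elements of `U`**: `diag(u, v)† J diag(u, v) = J ⟺ u† v = 1 ∧ v† u = 1`; so
`diag(u, (u†)⁻¹) ∈ U` for every invertible `u` — the source of non-`Sp` elements in the CM case.
DERIVED HERE. -/
theorem orlovIsometricBlock_diag_iff (σ : R →+* R) (u v : Matrix n n R) :
    ((fromBlocks u 0 0 v).map σ)ᵀ * (fromBlocks 0 1 (-1) 0 : Matrix (n ⊕ n) (n ⊕ n) R) * fromBlocks u 0 0 v = (fromBlocks 0 1 (-1) 0 : Matrix (n ⊕ n) (n ⊕ n) R) ↔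
      (u.map σ)ᵀ * v = 1 ∧ (v.map σ)ᵀ * u = 1 := by
  rw [fromBlocks_map, fromBlocks_transpose]
  simp only [map_zero_block, fromBlocks_multiply, transpose_zero, Matrix.zero_mul, Matrix.mul_zero, add_zero,
    zero_add, Matrix.mul_one, Matrix.mul_neg, Matrix.neg_mul, fromBlocks_inj]
  constructor
  · rintro ⟨-, h1, h2, -⟩
    exact ⟨h1, neg_injective h2⟩
  · rintro ⟨h1, h2⟩
    exact ⟨by simp, h1, by rw [h2], by simp⟩

/-- `U` is closed under products (in the form `f† J f = J`). DERIVED HERE. -/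
theorem orlovIsometricBlock_mul (σ : R →+* R) {F G : Matrix (n ⊕ n) (n ⊕ n) R}
    (hF : (F.map σ)ᵀ * (fromBlocks 0 1 (-1) 0 : Matrix (n ⊕ n) (n ⊕ n) R) * F = (fromBlocks 0 1 (-1) 0 : Matrix (n ⊕ n) (n ⊕ n) R)) (hG : (G.map σ)ᵀ * (fromBlocks 0 1 (-1) 0 : Matrix (n ⊕ n) (n ⊕ n) R) * G = (fromBlocks 0 1 (-1) 0 : Matrix (n ⊕ n) (n ⊕ n) R)) :
    ((F * G).map σ)ᵀ * (fromBlocks 0 1 (-1) 0 : Matrix (n ⊕ n) (n ⊕ n) R) * (F * G) = (fromBlocks 0 1 (-1) 0 : Matrix (n ⊕ n) (n ⊕ n) R) := by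
  rw [Matrix.map_mul, transpose_mul]
  calc (G.map σ)ᵀ * (F.map σ)ᵀ * (fromBlocks 0 1 (-1) 0 : Matrix (n ⊕ n) (n ⊕ n) R) * (F * G)
      = (G.map σ)ᵀ * ((F.map σ)ᵀ * (fromBlocks 0 1 (-1) 0 : Matrix (n ⊕ n) (n ⊕ n) R) * F) * G := by
        simp only [Matrix.mul_assoc]
    _ = (fromBlocks 0 1 (-1) 0 : Matrix (n ⊕ n) (n ⊕ n) R) := by rw [hF, hG]

/-- A `σ`-fixed symplectic matrix (e.g. the image of an element of `Sp_{2n}(ℤ)`) lies in `U`. DERIVED HERE. -/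
theorem orlovIsometricBlock_of_map_eq_self (σ : R →+* R) {H : Matrix (n ⊕ n) (n ⊕ n) R}
    (hfix : H.map σ = H) (hsp : Hᵀ * (fromBlocks 0 1 (-1) 0 : Matrix (n ⊕ n) (n ⊕ n) R) * H = (fromBlocks 0 1 (-1) 0 : Matrix (n ⊕ n) (n ⊕ n) R)) :
    (H.map σ)ᵀ * (fromBlocks 0 1 (-1) 0 : Matrix (n ⊕ n) (n ⊕ n) R) * H = (fromBlocks 0 1 (-1) 0 : Matrix (n ⊕ n) (n ⊕ n) R) := by
  rw [hfix]; exact hsp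

/-- Scalars `z · 1` with `z σ(z) = 1` (the roots of unity `μ_K` of a CM order) lie in `U`. DERIVED HERE. -/
theorem orlovIsometricBlock_smul_one (σ : R →+* R) {z : R} (hz : z * σ z = 1) :
    ((z • (1 : Matrix (n ⊕ n) (n ⊕ n) R)).map σ)ᵀ * (fromBlocks 0 1 (-1) 0 : Matrix (n ⊕ n) (n ⊕ n) R) *
        (z • (1 : Matrix (n ⊕ n) (n ⊕ n) R)) = (fromBlocks 0 1 (-1) 0 : Matrix (n ⊕ n) (n ⊕ n) R) := by
  have : (z • (1 : Matrix (n ⊕ n) (n ⊕ n) R)).map σ = σ z • (1 : Matrix (n ⊕ n) (n ⊕ n) R) := by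
    ext i j
    simp [Matrix.smul_apply, Matrix.one_apply, apply_ite σ]
  rw [this, transpose_smul, transpose_one, smul_mul_assoc, Matrix.one_mul, mul_smul_comm,
    Matrix.mul_one, smul_smul, hz, one_smul]

end BlockModel

section Witness

open QuadraticAlgebra

/-- **Witness, `ℤ[i]`, `n = 2`**: `F = diag(i, 1, i, 1)` (`i = ω` in `QuadraticAlgebra ℤ (-1) 0`, `σ = star`)
satisfies `F† J F = J`, i.e. `F ∈ U(E_i² × Ê_i²)` in the block model. DERIVED HERE (a computation). -/
theorem gaussInt_blockDiag_isometric :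
    ((fromBlocks !![(ω : QuadraticAlgebra ℤ (-1) 0), 0; 0, 1] 0 0 !![ω, 0; 0, 1]).map
          (starRingEnd (QuadraticAlgebra ℤ (-1) 0)))ᵀ *
        fromBlocks (0 : Matrix (Fin 2) (Fin 2) _) 1 (-1) 0 *
        fromBlocks !![(ω : QuadraticAlgebra ℤ (-1) 0), 0; 0, 1] 0 0 !![ω, 0; 0, 1] =
      fromBlocks (0 : Matrix (Fin 2) (Fin 2) _) 1 (-1) 0 := by
  rw [orlovIsometricBlock_diag_iff]
  have hu : ((!![(ω : QuadraticAlgebra ℤ (-1) 0), 0; 0, 1]).map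
      (starRingEnd (QuadraticAlgebra ℤ (-1) 0)))ᵀ * !![ω, 0; 0, 1] = 1 := by
    apply Matrix.ext
    intro i j
    fin_cases i <;> fin_cases j <;>
      simp [Matrix.mul_apply, Fin.sum_univ_two, QuadraticAlgebra.ext_iff, starRingEnd_apply]
  exact ⟨hu, hu⟩

/-- … and `F = diag(i, 1, i, 1)` is NOT `ζ · H` for any `ζ ∈ ℤ[i]` and any integer matrix `H`; with
`gaussInt_blockDiag_isometric`: `U(E_i² × Ê_i²) ⊋ μ₄ · Sp₄(ℤ)` (indeed `⊋ ℤ[i] · M₄(ℤ) ∩ U`), in contrast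
with `n = 1` (`U(E_i × Ê_i) = μ₄ · SL₂(ℤ)`, `OrlovIsometryGroupCMQuadratic.lean`). DERIVED HERE. -/
theorem gaussInt_blockDiag_ne_smul_intCast (z : QuadraticAlgebra ℤ (-1) 0)
    (H : Matrix (Fin 2 ⊕ Fin 2) (Fin 2 ⊕ Fin 2) ℤ) :
    fromBlocks !![(ω : QuadraticAlgebra ℤ (-1) 0), 0; 0, 1] 0 0 !![ω, 0; 0, 1] ≠
      z • H.map (Int.castRingHom (QuadraticAlgebra ℤ (-1) 0)) := by
  intro h
  have h11 := congrFun (congrFun h (Sum.inl 1)) (Sum.inl 1)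
  have h00 := congrFun (congrFun h (Sum.inl 0)) (Sum.inl 0)
  simp only [fromBlocks_apply₁₁, Matrix.smul_apply, Matrix.map_apply, eq_intCast, smul_eq_mul,
    of_apply, cons_val', cons_val_zero, cons_val_one, empty_val', cons_val_fin_one,
    QuadraticAlgebra.ext_iff, re_one, im_one, re_mul, im_mul, re_intCast, im_intCast, omega_re,
    omega_im, mul_zero, add_zero, zero_mul, zero_add] at h11 h00
  -- h11 : 1 = z.re * H₁₁ ∧ 0 = z.im * H₁₁ ;  h00 : 0 = z.re * H₀₀ ∧ 1 = z.im * H₀₀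
  obtain ⟨h11r, h11i⟩ := h11
  obtain ⟨-, h00i⟩ := h00
  have hzi : z.im = 0 := by
    rcases mul_eq_zero.mp h11i.symm with h | h
    · exact h
    · exfalso
      rw [h, mul_zero] at h11r
      exact one_ne_zero h11r
  rw [hzi, zero_mul] at h00i
  exact one_ne_zero h00i

end Witness

end Summit.Ventures.HSemireg
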